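import Literature.Probability.RandomPlanarGeometry.SAWPulledLargeForceExpansionZdBridgeWords
import HarnessLib

/-!
# «ZD-BRIDGE-SEARCH»: the two-level search for irreducible bridge words — vertical patterns by a certified trie, self-avoidance by the walk state

Topic `Literature/Probability/RandomPlanarGeometry` (sequel of `…ZdWordSearch` #593 / `…ZdTenStep` #601 / `…ZdBridgeWords` #622).  By
`costCoeffZd_eq_sum_search` (#622) a cost cell `N_{c,n+1}(ℤ^{d+1})` of the pulled large-force expansion is, in every dimension `d`, the
falling-factorial polynomial of the REDUCED SEARCH COUNTS of canonical bridge words, for any pruning test of the search engine whose meaning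
on words is the bridge class `QB c`.  This file supplies that test and proves its meaning:

* KERNEL SIDE (what the census cells evaluate): the VERTICAL PATTERN of a prefix relative to its first letter (`vlet`/`vpatF`/`fL`: up `0`,
  down `1`, transverse `2`), a TRIE over this alphabet (`Tri`, `inTrie`), and the pruning test ★ `okT tr n` = «the vertical pattern so far is
  a trie prefix, and the endpoint is new (`okR`)», with the trivial class test `clsT` (the trie accepts exactly the valid complete patterns);
* WORD SIDE: the pattern of a word (`vletW`/`vpatW`, ★ `vpatF_st`: the state's pattern is the word's pattern prefix), pattern heights
  (`dh`/`hP`, ★ `hP_vpatW`: they are the relative heights `Hgt` of #622), and the COMPUTABLE VALIDITY of a pattern `validPatB c` (bridge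
  `bridgeB`, cost `costB`, no renewal time `renewalB`) with ★★ `validPatB_iff`: «irreducible bridge pattern of cost `c`» on the heights;
* THE TRIE CERTIFICATE: a self-avoiding word has no immediate vertical reversal (`noRev`, ★ `noRev_vpatW`), so a trie need only be exact on
  reversal-free patterns; ★ `patOK tr c k r` checks by a pruned recursion that `inTrie tr p = validPatB c p` on every reversal-free extension
  `p` of a prefix, and ★★ `patOK_sound` is its adequacy — for a concrete trie ONE `decide` certifies it;
* ★★★ `search_iff_qb`: for a certified trie, «every prefix passes `okT`» is EXACTLY the bridge class `QB c`; hence ★★★ `costCoeffZd_eq_sum_trie`: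
  `N_{c,n+1}(ℤ^{d+1}) = Σ_k 2^k m_{k+1} d^{(k)}` with `m_k` the reduced two-level search counts — what remains for a cell is kernel evaluation;
* ASSEMBLY HELPERS for cells evaluated in pieces (the kernel's memory budget caps one evaluation at ≈ 15 000 search nodes): one level of the
  search as an explicit sum over the children `kids` (★ `dfsV_succ_eq_sum_kids`), dead children (`dfsV_of_not_ok`), so that a census value is
  the sum of its sub-cell values;
* THE CERTIFIED TRIES `tr9_11` (62 patterns) and `tr9_12` (91 patterns) of the two remaining cells of the cost-nine column, with their certificates
  ★ `patOK_tr9_11`, ★ `patOK_tr9_12` (one `decide` each) — the sequels «ZD-BRIDGE-NINE-ELEVEN» / «ZD-BRIDGE-NINE-TWELVE» evaluate the cells.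
[cite: MadrasSlade1993, Definition 1.2.4; §4.2, eq. (4.2.20)–(4.2.22) (p. 94, 2013 reprint)]
The definitions `Tri`, `inTrie`, `vlet`, `vpatF`, `fL`, `okT`, `clsT`, `vletW`, `vpatW`, `dh`, `hP`, `bridgeB`, `renewalB`, `costB`, `validPatB`,
`rev2`, `noRev`, `revHead`, `patOK`, `kids`, `tr9_11`, `tr9_12` are this file's tool notions (not notions in print).  No number is taken from print.

Provenance: lane «pcv-sawmu», a-p3 g20 (kernel design and the pattern semantics, 2026-08-26) / a-p3 g21 (trie certificate, `search_iff_qb`,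
assembly helpers, 2026-08-27).
-/

open Finset
open scoped BigOperators
open Literature.Probability.LatticeModels
open Literature.Probability.RandomPlanarGeometry.SAW

namespace Literature.Probability.RandomPlanarGeometry.SAW.Zd

namespace WordTypes

/-! ### Kernel side: vertical patterns, tries, the two-level pruning test -/

section kernelside

/-- A trie over the vertical alphabet up `0` / down `1` / transverse `2`: `no` = dead prefix, `yes` = accepted, `br u d t` = the three children.
[cite: MadrasSlade1993, Definition 1.2.4] -/
inductive Tri where
  | no : Tri
  | yes : Tri
  | br : Tri → Tri → Tri → Tri

/-- Walk the trie along a vertical pattern; a prefix ending at an inner node passes, `yes` accepts everything below it.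
[cite: MadrasSlade1993, Definition 1.2.4] -/
def inTrie : Tri → List ℕ → Bool
  | Tri.no, _ => false
  | Tri.yes, _ => true
  | Tri.br _ _ _, [] => true
  | Tri.br u d t, x :: rest => inTrie (if x == 0 then u else if x == 1 then d else t) rest

/-- The vertical letter of a raw letter `a` relative to the first letter `f`: `0` = same letter (up), `1` = its reversal (down), `2` = transverse.
[cite: MadrasSlade1993, Definition 1.2.4] -/
def vlet (f a : ℕ × Bool) : ℕ := if a.1 == f.1 then (if a.2 == f.2 then 0 else 1) else 2

/-- The vertical pattern of a reversed raw prefix `s`, in forward order. [cite: MadrasSlade1993, Definition 1.2.4] -/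
def vpatF (f : ℕ × Bool) (s : List (ℕ × Bool)) : List ℕ := (s.map (vlet f)).reverse

/-- The first letter of the word (the last of the reversed prefix; `(0, true)` for the empty prefix). [cite: MadrasSlade1993, Definition 1.2.4] -/
def fL (s : List (ℕ × Bool)) : ℕ × Bool := s.getLastD (0, true)

/-- ★ THE TWO-LEVEL PRUNING TEST over `n` axes: the vertical pattern of the prefix is a prefix of the trie `tr` (fast branch when the first
letter is `(0,true)`, as for every canonical bridge word), and the endpoint of the prefix is a new point (`okR`). [cite: MadrasSlade1993, Definition 1.2.4] -/
def okT (tr : Tri) (n : ℕ) (s : List (ℕ × Bool)) : Bool :=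
  (if fL s == (0, true) then inTrie tr (vpatF (0, true) s) else inTrie tr (vpatF (fL s) s)) && okR n s

/-- The class test of the two-level search: one class, everything that survives to full length. [cite: MadrasSlade1993, Definition 1.2.4] -/
def clsT : ℕ → List (ℕ × Bool) → Bool
  | 0 => fun _ => true
  | _ => fun _ => false

/-- The fast branch of `okT` equals the generic one. [cite: MadrasSlade1993, Definition 1.2.4] -/
theorem okT_eq (tr : Tri) (n : ℕ) (s : List (ℕ × Bool)) : okT tr n s = (inTrie tr (vpatF (fL s) s) && okR n s) := by
  unfold okT
  by_cases h : fL s = (0, true)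
  · simp [h]
  · rw [if_neg (by simpa using h)]

/-- Passing the trie is prefix-closed. [cite: MadrasSlade1993, Definition 1.2.4] -/
theorem inTrie_take : ∀ (t : Tri) (p : List ℕ) (i : ℕ), inTrie t p = true → inTrie t (p.take i) = true
  | Tri.no, p, i, h => by simp [inTrie] at h
  | Tri.yes, p, i, h => by simp [inTrie]
  | Tri.br u d t, [], i, h => by simp [inTrie]
  | Tri.br u d t, x :: rest, 0, h => by simp [inTrie]
  | Tri.br u d t, x :: rest, i + 1, h => by
    simp only [inTrie, List.take_succ_cons] at h ⊢
    exact inTrie_take _ rest i h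

end kernelside


/-! ### Word side: the vertical pattern of a word and the pattern of the search state -/

section wordside

variable {n D : ℕ}

/-- The vertical letter at position `p` relative to the first letter (word level). [cite: MadrasSlade1993, Definition 1.2.4] -/
def vletW (u : Word (n + 1) D) (p : Fin (n + 1)) : ℕ := if (u p).1 = (u 0).1 then (if (u p).2 = (u 0).2 then 0 else 1) else 2

/-- The vertical pattern of a word (forward, length `n+1`). [cite: MadrasSlade1993, Definition 1.2.4] -/
def vpatW (u : Word (n + 1) D) : List ℕ := List.ofFn (vletW u)

/-- The pattern has the length of the word. [cite: MadrasSlade1993, Definition 1.2.4] -/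
@[simp] theorem length_vpatW (u : Word (n + 1) D) : (vpatW u).length = n + 1 := by simp [vpatW]

/-- The first vertical letter is `0`. [cite: MadrasSlade1993, Definition 1.2.4] -/
theorem vletW_zero (u : Word (n + 1) D) : vletW u 0 = 0 := by simp [vletW]

/-- Vertical letters are `≤ 2`. [cite: MadrasSlade1993, Definition 1.2.4] -/
theorem vletW_le (u : Word (n + 1) D) (p : Fin (n + 1)) : vletW u p ≤ 2 := by
  unfold vletW; split_ifs <;> omega

/-- The pattern is `0 ::` its tail. [cite: MadrasSlade1993, Definition 1.2.4] -/
theorem vpatW_eq_cons (u : Word (n + 1) D) : vpatW u = 0 :: List.ofFn fun i : Fin n => vletW u i.succ := by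
  rw [vpatW, List.ofFn_succ, vletW_zero]

/-- Vertical letter `0` means the letter IS the first letter. [cite: MadrasSlade1993, Definition 1.2.4] -/
theorem vletW_eq_zero_iff (u : Word (n + 1) D) (p : Fin (n + 1)) : vletW u p = 0 ↔ u p = u 0 := by
  unfold vletW
  constructor
  · intro h
    split_ifs at h with h1 h2
    exact Prod.ext h1 h2
  · intro h; simp [h]

/-- Vertical letter `1` means the letter is the REVERSAL of the first letter. [cite: MadrasSlade1993, Definition 1.2.4] -/
theorem vletW_eq_one_iff (u : Word (n + 1) D) (p : Fin (n + 1)) : vletW u p = 1 ↔ u p = ((u 0).1, !(u 0).2) := by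
  unfold vletW
  constructor
  · intro h
    by_cases h1 : (u p).1 = (u 0).1
    · by_cases h2 : (u p).2 = (u 0).2
      · rw [if_pos h1, if_pos h2] at h; exact absurd h (by decide)
      · refine Prod.ext h1 ?_
        simp only
        cases hb : (u p).2 <;> cases hb0 : (u 0).2 <;> simp_all
    · rw [if_neg h1] at h; exact absurd h (by decide)
  · intro h
    rw [h]
    simp only [if_true]
    cases (u 0).2 <;> simp

/-- Raw and word-level vertical letters agree. [cite: MadrasSlade1993, Definition 1.2.4] -/
theorem vlet_raw (u : Word (n + 1) D) (p : Fin (n + 1)) : vlet (raw (u 0)) (raw (u p)) = vletW u p := by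
  unfold vlet vletW raw
  simp only [Fin.val_inj, Bool.beq_eq_decide_eq, decide_eq_true_eq]

/-- The reversed prefix of the first `i+1` letters ends with the first letter. [cite: MadrasSlade1993, Definition 1.2.4] -/
theorem fL_st (u : Word (n + 1) D) (i : ℕ) : fL (st updR [] ((rawW u).take (i + 1))) = raw (u 0) := by
  rw [st_updR, List.append_nil, fL, List.getLastD_eq_getLast?, List.getLast?_reverse, rawW, List.take_add_one]
  simp only [List.head?_append, List.head?_take]
  rw [List.ofFn_succ]
  cases i with
  | zero => simp
  | succ i => simp

/-- ★ The vertical pattern of the state after `i+1` letters is the word's pattern prefix. [cite: MadrasSlade1993, Definition 1.2.4] -/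
theorem vpatF_st (u : Word (n + 1) D) (i : ℕ) :
    vpatF (fL (st updR [] ((rawW u).take (i + 1)))) (st updR [] ((rawW u).take (i + 1))) = (vpatW u).take (i + 1) := by
  rw [fL_st u i, st_updR, List.append_nil, vpatF, List.map_reverse, List.reverse_reverse, rawW, List.map_take, List.map_ofFn]
  unfold vpatW
  congr 1
  exact congrArg List.ofFn (funext fun p => vlet_raw u p)

/-- The empty state passes the trie part iff the trie is not dead at the root, which `inTrie tr [] = true` says. [cite: MadrasSlade1993, Definition 1.2.4] -/
theorem okT_nil (tr : Tri) (m : ℕ) (h : inTrie tr [] = true) : okT tr m ([] : List (ℕ × Bool)) = true := by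
  rw [okT_eq]; simpa [vpatF, fL, okR, retZ] using h

end wordside


/-! ### Heights of a vertical pattern; the computable validity of a pattern and its meaning -/

section patterns

variable {n D : ℕ}

/-- The height increment of a vertical letter: up `+1`, down `−1`, transverse `0`. [cite: MadrasSlade1993, Definition 1.2.4] -/
def dh (x : ℕ) : ℤ := if x = 0 then 1 else if x = 1 then -1 else 0

/-- The height after the first `i` letters of a pattern. [cite: MadrasSlade1993, Definition 1.2.4] -/
def hP (pat : List ℕ) (i : ℕ) : ℤ := ((pat.take i).map dh).sum

/-- The relative vertical sign of #622 is the height increment of the vertical letter. [cite: MadrasSlade1993, Definition 1.2.4] -/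
theorem vs_eq_dh (u : Word (n + 1) D) (p : Fin (n + 1)) : vs (u 0) (u p) = dh (vletW u p) := by
  unfold vs vletW dh
  by_cases h : (u p).1 = (u 0).1
  · rw [if_pos h, if_pos h]
    by_cases h2 : (u p).2 = (u 0).2
    · rw [if_pos h2, if_pos h2]; simp
    · rw [if_neg h2, if_neg h2]; simp
  · rw [if_neg h, if_neg h]; simp

/-- ★ The pattern heights of a word are its relative heights `Hgt` (for `i ≤ n+1`). [cite: MadrasSlade1993, Definition 1.2.4] -/
theorem hP_vpatW (u : Word (n + 1) D) : ∀ i, i ≤ n + 1 → hP (vpatW u) i = Hgt u i := by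
  intro i
  induction i with
  | zero => intro _; simp [hP, hgt_zero]
  | succ i ih =>
    intro hi
    have hlt : i < n + 1 := by omega
    rw [hgt_succ u hlt, ← ih hlt.le, hP, hP, vpatW, List.take_add_one, List.getElem?_ofFn, dif_pos hlt]
    simp [vs_eq_dh]

/-- `hP pat 0 = 0`. [cite: MadrasSlade1993, Definition 1.2.4] -/
theorem hP_zero (pat : List ℕ) : hP pat 0 = 0 := by simp [hP]

/-- Beyond the length the height is frozen. [cite: MadrasSlade1993, Definition 1.2.4] -/
theorem hP_of_length_le (pat : List ℕ) {i : ℕ} (hi : pat.length ≤ i) : hP pat i = hP pat pat.length := by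
  unfold hP; rw [List.take_of_length_le hi, List.take_length]

/-- ★ All pattern heights of a word are its relative heights (both are frozen after the last letter). [cite: MadrasSlade1993, Definition 1.2.4] -/
theorem hP_vpatW_all (u : Word (n + 1) D) (i : ℕ) : hP (vpatW u) i = Hgt u i := by
  rcases Nat.lt_or_ge (n + 1) i with hi | hi
  · rw [hP_of_length_le _ (by simp; omega), length_vpatW, hP_vpatW u (n + 1) le_rfl, hgt_of_le u hi.le]
  · exact hP_vpatW u i hi

/-- Bridge condition on a pattern: heights `1 ≤ h_i ≤ h_L` for `1 ≤ i ≤ L`. [cite: MadrasSlade1993, Definition 1.2.4] -/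
def bridgeB (pat : List ℕ) : Bool :=
  (List.range pat.length).all fun i => decide (1 ≤ hP pat (i + 1)) && decide (hP pat (i + 1) ≤ hP pat pat.length)

/-- Renewal time `t` of a pattern: all earlier heights `≤ h_t`, all later heights `> h_t`. [cite: MadrasSlade1993, Definition 1.2.4] -/
def renewalB (pat : List ℕ) (t : ℕ) : Bool :=
  ((List.range (t + 1)).all fun s => decide (hP pat s ≤ hP pat t)) &&
    ((List.range (pat.length - t)).all fun k => decide (hP pat t < hP pat (t + 1 + k)))

/-- Cost of a pattern: transverse letters `1`, down letters `2`. [cite: MadrasSlade1993, §4.2, eq. (4.2.20)–(4.2.22) (p. 94, 2013 reprint)] -/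
def costB (pat : List ℕ) : ℕ := (pat.map fun x => if x = 0 then 0 else if x = 1 then 2 else 1).sum

/-- ★ VALID PATTERN of the cost cell: bridge, cost `c`, no renewal time in `[1, L-1]`. [cite: MadrasSlade1993, §4.2, eq. (4.2.20)–(4.2.22) (p. 94, 2013 reprint)] -/
def validPatB (c : ℕ) (pat : List ℕ) : Bool :=
  bridgeB pat && (costB pat == c) && (List.range (pat.length - 1)).all fun t => !renewalB pat (t + 1)

/-- ★ `bridgeB` is the bridge condition on the pattern heights. [cite: MadrasSlade1993, Definition 1.2.4] -/
theorem bridgeB_iff (pat : List ℕ) : bridgeB pat = true ↔ IsBridgeH pat.length (hP pat) := by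
  unfold bridgeB IsBridgeH
  simp only [List.all_eq_true, List.mem_range, Bool.and_eq_true, decide_eq_true_eq, hP_zero]
  constructor
  · intro h i hi1 hi2
    obtain ⟨h1, h2⟩ := h (i - 1) (by omega)
    rw [show i - 1 + 1 = i by omega] at h1 h2
    exact ⟨by omega, h2⟩
  · intro h i hi
    obtain ⟨h1, h2⟩ := h (i + 1) (by omega) (by omega)
    exact ⟨by omega, h2⟩

/-- ★ Under the bridge condition, `renewalB` at `1 ≤ t ≤ L-1` is the renewal condition on the pattern heights. [cite: MadrasSlade1993, Definition 1.2.4] -/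
theorem renewalB_iff (pat : List ℕ) (hb : IsBridgeH pat.length (hP pat)) {t : ℕ} (ht1 : 1 ≤ t) (ht2 : t ≤ pat.length - 1) :
    renewalB pat t = true ↔ IsRenewalH pat.length (hP pat) t := by
  unfold renewalB IsRenewalH IsBridgeH
  simp only [List.all_eq_true, List.mem_range, Bool.and_eq_true, decide_eq_true_eq, hP_zero, Nat.add_zero]
  have h0t : 0 < hP pat t := (hb t ht1 (by omega)).1
  constructor
  · rintro ⟨hle, hgt⟩
    refine ⟨by omega, fun i hi1 hi2 => ⟨(hb i hi1 (by omega)).1, hle i (by omega)⟩, fun k hk1 hk2 => ⟨?_, ?_⟩⟩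
    · have := hgt (k - 1) (by omega)
      rwa [show t + 1 + (k - 1) = t + k by omega] at this
    · rw [show t + (pat.length - t) = pat.length by omega]
      exact (hb (t + k) (by omega) (by omega)).2
  · rintro ⟨-, hA, hB⟩
    refine ⟨fun i hi => ?_, fun k hk => ?_⟩
    · rcases Nat.eq_zero_or_pos i with rfl | hi0
      · rw [hP_zero]; omega
      · exact (hA i hi0 (by omega)).2
    · have := (hB (k + 1) (by omega) (by omega)).1
      rwa [show t + (k + 1) = t + 1 + k by omega] at this

/-- The cost of a pattern is its length minus its final height. [cite: MadrasSlade1993, §4.2, eq. (4.2.20)–(4.2.22) (p. 94, 2013 reprint)] -/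
theorem costB_add_hP (pat : List ℕ) : (costB pat : ℤ) + hP pat pat.length = pat.length := by
  unfold costB hP
  rw [List.take_length]
  induction pat with
  | nil => simp
  | cons x pat ih =>
    simp only [List.map_cons, List.sum_cons, List.length_cons] at ih ⊢
    push_cast at ih ⊢
    have hdx : (if x = 0 then (0 : ℤ) else if x = 1 then 2 else 1) + dh x = 1 := by
      unfold dh
      rcases (by omega : x = 0 ∨ x = 1 ∨ 2 ≤ x) with rfl | rfl | hx
      · simp
      · simp
      · simp [show x ≠ 0 by omega, show x ≠ 1 by omega]
    linarith

/-- ★★ `validPatB c` is «irreducible bridge pattern of cost `c`» on the pattern heights. [cite: MadrasSlade1993, §4.2, eq. (4.2.20)–(4.2.22) (p. 94, 2013 reprint)] -/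
theorem validPatB_iff (c : ℕ) (pat : List ℕ) (hL : 1 ≤ pat.length) :
    validPatB c pat = true ↔ IsIrrH pat.length (hP pat) ∧ pat.length - (hP pat pat.length).toNat = c := by
  unfold validPatB IsIrrH
  rw [Bool.and_eq_true, Bool.and_eq_true, bridgeB_iff, beq_iff_eq]
  simp only [List.all_eq_true, List.mem_range, Bool.not_eq_true']
  constructor
  · rintro ⟨⟨hb, hc⟩, hirr⟩
    refine ⟨⟨hL, hb, fun k hk1 hk2 hren => ?_⟩, ?_⟩
    · have := hirr (k - 1) (by omega)
      rw [show k - 1 + 1 = k by omega, ← Bool.not_eq_true] at this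
      exact this ((renewalB_iff pat hb hk1 hk2).2 hren)
    · have h1 := costB_add_hP pat
      have hpos : 0 < hP pat pat.length := by
        have := (hb pat.length hL le_rfl).1; rwa [hP_zero] at this
      have : ((hP pat pat.length).toNat : ℤ) = hP pat pat.length := Int.toNat_of_nonneg hpos.le
      omega
  · rintro ⟨⟨-, hb, hirr⟩, hc⟩
    refine ⟨⟨hb, ?_⟩, fun t ht => ?_⟩
    · have h1 := costB_add_hP pat
      have hpos : 0 < hP pat pat.length := by
        have := (hb pat.length hL le_rfl).1; rwa [hP_zero] at this
      have : ((hP pat pat.length).toNat : ℤ) = hP pat pat.length := Int.toNat_of_nonneg hpos.le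
      omega
    · rw [← Bool.not_eq_true, renewalB_iff pat hb (by omega) (by omega)]
      exact hirr (t + 1) (by omega) (by omega)

/-- ★ On a word: `validPatB c (vpatW u)` is the bridge class condition of #622 on the relative heights. [cite: MadrasSlade1993, §4.2, eq. (4.2.20)–(4.2.22) (p. 94, 2013 reprint)] -/
theorem validPatB_vpatW_iff (c : ℕ) (u : Word (n + 1) D) :
    validPatB c (vpatW u) = true ↔ IsIrrH (n + 1) (Hgt u) ∧ n + 1 - (Hgt u (n + 1)).toNat = c := by
  rw [validPatB_iff c (vpatW u) (by simp), length_vpatW, isIrrH_congr (hP_vpatW_all u), hP_vpatW_all]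

end patterns


/-! ### The trie certificate: exactness on reversal-free patterns -/

section certificate

variable {n D : ℕ}

/-- Two consecutive vertical letters form an immediate reversal (`up, down` or `down, up`). [cite: MadrasSlade1993, Definition 1.2.4] -/
def rev2 (x y : ℕ) : Bool := (x == 0 && y == 1) || (x == 1 && y == 0)

/-- A pattern without immediate vertical reversals. [cite: MadrasSlade1993, Definition 1.2.4] -/
def noRev : List ℕ → Bool
  | x :: y :: rest => !rev2 x y && noRev (y :: rest)
  | _ => true

/-- Dropping the head keeps `noRev`. [cite: MadrasSlade1993, Definition 1.2.4] -/
theorem noRev_tail {x : ℕ} {l : List ℕ} (h : noRev (x :: l) = true) : noRev l = true := by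
  cases l with
  | nil => rfl
  | cons y rest => simp only [noRev, Bool.and_eq_true] at h; exact h.2

/-- Dropping a prefix keeps `noRev`. [cite: MadrasSlade1993, Definition 1.2.4] -/
theorem noRev_of_append {l₁ l₂ : List ℕ} (h : noRev (l₁ ++ l₂) = true) : noRev l₂ = true := by
  induction l₁ with
  | nil => simpa using h
  | cons x l ih => exact ih (noRev_tail (by simpa using h))

/-- A reversal-free pattern has no reversal at any two consecutive places. [cite: MadrasSlade1993, Definition 1.2.4] -/
theorem rev2_eq_false_of_noRev {l : List ℕ} {y x : ℕ} {q : List ℕ} (h : noRev (l ++ y :: x :: q) = true) : rev2 y x = false := by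
  have h2 := noRev_of_append h
  simp only [noRev, Bool.and_eq_true, Bool.not_eq_true'] at h2
  exact h2.1

/-- `noRev` in terms of indices. [cite: MadrasSlade1993, Definition 1.2.4] -/
theorem noRev_iff_get : ∀ l : List ℕ, noRev l = true ↔ ∀ i (h : i + 1 < l.length), rev2 (l[i]'(by omega)) (l[i + 1]'h) = false
  | [] => by simp [noRev]
  | [x] => by simp [noRev]
  | x :: y :: rest => by
    rw [noRev, Bool.and_eq_true, noRev_iff_get (y :: rest), Bool.not_eq_true']
    constructor
    · rintro ⟨h1, h2⟩ i hi
      cases i with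
      | zero => exact h1
      | succ i => exact h2 i (by simpa using hi)
    · intro h
      exact ⟨h 0 (by simp), fun i hi => h (i + 1) (by simpa using hi)⟩

/-- ★ A SELF-AVOIDING WORD HAS NO IMMEDIATE VERTICAL REVERSAL (its pattern is reversal-free): two consecutive letters `a`, `a`-reversed return
to the previous point. [cite: MadrasSlade1993, Definition 1.2.4] -/
theorem noRev_vpatW (u : Word (n + 1) D) (hu : Percolation.IsSAW u) : noRev (vpatW u) = true := by
  rw [noRev_iff_get]
  intro i hi
  rw [length_vpatW] at hi
  have hi0 : i < n + 1 := by omega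
  have e0 : (vpatW u)[i]'(by simp; omega) = vletW u ⟨i, hi0⟩ := by simp only [vpatW, List.getElem_ofFn]
  have e1 : (vpatW u)[i + 1]'(by simpa using hi) = vletW u ⟨i + 1, hi⟩ := by simp only [vpatW, List.getElem_ofFn]
  rw [e0, e1]
  -- the block of the two letters would vanish
  have hblock : bsumW u i (i + 2) ≠ 0 := (isSAW_iff_blocks u).1 hu i (i + 2) (by omega) (by omega)
  rw [show i + 2 = i + 1 + 1 from rfl, bsumW_succ u (by omega) hi, bsumW_succ u le_rfl hi0, bsumW_self, zero_add] at hblock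
  rw [Bool.eq_false_iff]
  intro hrev
  unfold rev2 at hrev
  simp only [Bool.or_eq_true, Bool.and_eq_true, beq_iff_eq] at hrev
  apply hblock
  rcases hrev with ⟨h0, h1⟩ | ⟨h1, h0⟩
  · rw [(vletW_eq_zero_iff u _).1 h0, (vletW_eq_one_iff u _).1 h1, show u 0 = ((u 0).1, (u 0).2) from rfl, twoStepV_not]
    simp
  · rw [(vletW_eq_one_iff u _).1 h1, (vletW_eq_zero_iff u _).1 h0, show u 0 = ((u 0).1, (u 0).2) from rfl, twoStepV_not]
    simp

/-- Extending the reversed prefix `r` by the letter `x` creates an immediate reversal. [cite: MadrasSlade1993, Definition 1.2.4] -/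
def revHead : List ℕ → ℕ → Bool
  | y :: _, x => rev2 y x
  | [], _ => false

/-- ★ THE CERTIFICATE CHECKER: `patOK tr c k r` — for every reversal-free extension of the reversed prefix `r` by `k` vertical letters, the
trie's verdict equals the computable validity `validPatB c` (a pruned recursion: an extension creating a reversal is skipped).
[cite: MadrasSlade1993, Definition 1.2.4] -/
def patOK (tr : Tri) (c : ℕ) : ℕ → List ℕ → Bool
  | 0, r => inTrie tr r.reverse == validPatB c r.reverse
  | k + 1, r => [0, 1, 2].all fun x => revHead r x || patOK tr c k (x :: r)

/-- ★★ ADEQUACY OF THE CHECKER: if `patOK tr c k r` holds then the trie is exact on every reversal-free `k`-letter extension of `r.reverse`.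
[cite: MadrasSlade1993, Definition 1.2.4] -/
theorem patOK_sound (tr : Tri) (c : ℕ) : ∀ (k : ℕ) (r : List ℕ), patOK tr c k r = true →
    ∀ q : List ℕ, q.length = k → (∀ x ∈ q, x ≤ 2) → noRev (r.reverse ++ q) = true →
      inTrie tr (r.reverse ++ q) = validPatB c (r.reverse ++ q) := by
  intro k
  induction k with
  | zero =>
    intro r h q hq _ _
    rw [List.length_eq_zero_iff] at hq
    subst hq
    simpa [patOK] using h
  | succ k ih =>
    intro r h q hq hx hnr
    obtain ⟨x, q', rfl⟩ : ∃ x q', q = x :: q' := by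
      cases q with
      | nil => simp at hq
      | cons x q' => exact ⟨x, q', rfl⟩
    have hx2 : x ≤ 2 := hx x (by simp)
    have hmem : x ∈ [0, 1, 2] := by
      rcases (by omega : x = 0 ∨ x = 1 ∨ x = 2) with rfl | rfl | rfl <;> simp
    rw [patOK, List.all_eq_true] at h
    have hx' := h x hmem
    rw [Bool.or_eq_true] at hx'
    have e : r.reverse ++ x :: q' = (x :: r).reverse ++ q' := by simp
    rcases hx' with hrev | hok
    · -- an immediate reversal contradicts `noRev`
      cases r with
      | nil => simp [revHead] at hrev
      | cons y r' =>
        exfalso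
        have : rev2 y x = false := rev2_eq_false_of_noRev (l := r'.reverse) (q := q') (by simpa using hnr)
        rw [revHead, this] at hrev
        exact Bool.false_ne_true hrev
    · rw [e] at hnr ⊢
      exact ih (x :: r) hok q' (by simpa using hq) (fun y hy => hx y (by simp [hy])) hnr

/-- ★★ A CERTIFIED TRIE IS EXACT ON THE PATTERNS OF SELF-AVOIDING WORDS: if `patOK tr c n [0]` holds, then for every self-avoiding word of
length `n+1` the trie accepts its vertical pattern iff the pattern is a valid pattern of cost `c`. [cite: MadrasSlade1993, Definition 1.2.4] -/
theorem inTrie_vpatW_eq (tr : Tri) (c : ℕ) (htr : patOK tr c n [0] = true) (u : Word (n + 1) D) (hu : Percolation.IsSAW u) :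
    inTrie tr (vpatW u) = validPatB c (vpatW u) := by
  have h := patOK_sound tr c n [0] htr (List.ofFn fun i : Fin n => vletW u i.succ) (by simp)
    (fun x hx => by
      rw [List.mem_ofFn] at hx
      obtain ⟨i, rfl⟩ := hx
      exact vletW_le u _)
  rw [List.reverse_singleton, List.singleton_append, ← vpatW_eq_cons] at h
  exact h (noRev_vpatW u hu)

end certificate


/-! ### ★★★ The meaning of the two-level search: the bridge class -/

section meaning

variable {n : ℕ}

/-- All prefixes pass the trie part iff the whole pattern passes (prefix closure), for a trie alive at the root. [cite: MadrasSlade1993, Definition 1.2.4] -/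
theorem forall_inTrie_take_iff (tr : Tri) (h0 : inTrie tr [] = true) (p : List ℕ) :
    (∀ i, i ≤ p.length → inTrie tr (p.take i) = true) ↔ inTrie tr p = true := by
  constructor
  · intro h; simpa using h p.length le_rfl
  · intro h i _
    rcases Nat.eq_zero_or_pos i with rfl | _
    · simpa using h0
    · exact inTrie_take tr p i h

/-- ★★★ THE SEARCH MEANS THE BRIDGE CLASS: for a trie certified by `patOK tr c n [0]` (and alive at the root), a word of length `n+1` over
`n+1` axes passes the two-level test `okT tr (n+1)` at every prefix (class test `clsT 0` trivial) iff it lies in the bridge class `QB c` of #622: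
self-avoiding, irreducible bridge along its first letter, cost `c`. [cite: MadrasSlade1993, §4.2, eq. (4.2.20)–(4.2.22) (p. 94, 2013 reprint)] -/
theorem search_iff_qb (tr : Tri) (c : ℕ) (htr : patOK tr c n [0] = true) (h0 : inTrie tr [] = true) (τ : Word (n + 1) (n + 1)) :
    (PrefixOK updR (okT tr (n + 1)) ([] : List (ℕ × Bool)) τ ∧ clsT 0 (st updR [] (rawW τ)) = true) ↔ QB c τ := by
  have hcls : clsT 0 (st updR [] (rawW τ)) = true := rfl
  simp only [hcls, and_true]
  -- split the pruning test into its two conjuncts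
  have hsplit : PrefixOK updR (okT tr (n + 1)) ([] : List (ℕ × Bool)) τ ↔
      (∀ i : Fin (n + 1 + 1), inTrie tr (vpatF (fL (st updR [] ((rawW τ).take i.val))) (st updR [] ((rawW τ).take i.val))) = true) ∧
        PrefixOK updR (okR (n + 1)) ([] : List (ℕ × Bool)) τ := by
    unfold PrefixOK
    simp only [okT_eq, Bool.and_eq_true]
    exact ⟨fun h => ⟨fun i => (h i).1, fun i => (h i).2⟩, fun h i => ⟨h.1 i, h.2 i⟩⟩
  -- the trie conjunct is «the whole pattern passes»
  have htrie : (∀ i : Fin (n + 1 + 1), inTrie tr (vpatF (fL (st updR [] ((rawW τ).take i.val))) (st updR [] ((rawW τ).take i.val))) = true) ↔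
      inTrie tr (vpatW τ) = true := by
    rw [← forall_inTrie_take_iff tr h0, length_vpatW]
    constructor
    · intro h i hi
      rcases Nat.eq_zero_or_pos i with rfl | hi0
      · simpa using h0
      · obtain ⟨j, rfl⟩ : ∃ j, i = j + 1 := ⟨i - 1, by omega⟩
        have := h ⟨j + 1, by omega⟩
        rwa [vpatF_st τ j] at this
    · intro h i
      rcases Nat.eq_zero_or_pos i.val with hi | hi0
      · rw [hi, List.take_zero]
        simpa [st, vpatF] using h0
      · obtain ⟨j, hj⟩ : ∃ j, i.val = j + 1 := ⟨i.val - 1, by omega⟩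
        rw [hj, vpatF_st τ j]
        exact h (j + 1) (by omega)
  rw [hsplit, htrie, prefixOK_iff_blocks, ← isSAW_iff_blocks]
  unfold QB
  constructor
  · rintro ⟨ht, hs⟩
    rw [inTrie_vpatW_eq tr c htr τ hs, validPatB_vpatW_iff] at ht
    exact ⟨hs, ht⟩
  · rintro ⟨hs, hq⟩
    rw [inTrie_vpatW_eq tr c htr τ hs, validPatB_vpatW_iff]
    exact ⟨hq, hs⟩

open Classical in
/-- ★★★ **THE COST CENSUS BY THE TWO-LEVEL SEARCH**: for a trie certified by `patOK tr c n [0]`, `N_{c,n+1}(ℤ^{d+1}) = Σ_{k<n+1} 2^k m_{k+1} d^{(k)}`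
in every dimension `d`, with `m_k = dfsN alwR updR (okT tr (n+1)) clsT 0 k (n+1) [] 0` the reduced two-level search counts (canonical irreducible
bridge words of cost `c` with positive first occurrences and `k` axes in all). [cite: MadrasSlade1993, §4.2, eq. (4.2.20)–(4.2.22) (p. 94, 2013 reprint)] -/
theorem costCoeffZd_eq_sum_trie (d c n : ℕ) (tr : Tri) (htr : patOK tr c n [0] = true) (h0 : inTrie tr [] = true) (m : ℕ → ℕ)
    (hm : ∀ k, k ≤ n + 1 → dfsN alwR updR (okT tr (n + 1)) clsT 0 k (n + 1) ([] : List (ℕ × Bool)) 0 = m k) (hm0 : m 0 = 0) :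
    costCoeffZd d c (n + 1) = ∑ k ∈ Finset.range (n + 1), 2 ^ k * m (k + 1) * d.descFactorial k :=
  costCoeffZd_eq_sum_search (okT tr (n + 1)) clsT d c 0 (search_iff_qb tr c htr h0) m hm hm0

end meaning


/-! ### Assembly helpers: a census value as the sum of its children's values -/

section assembly

variable {S : Type*} (alw : ℕ → ℕ × Bool → Bool) (upd : S → ℕ × Bool → S) (ok : S → Bool) (cls : ℕ → S → Bool)

/-- The children of a search node: the next states with their axis counts, in the order the search visits them. [cite: MadrasSlade1993, Definition 1.2.4] -/
def kids (s : S) (m : ℕ) : List (S × ℕ) := (lts alw m).map fun a => (upd s a, nxt m a)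

/-- ★ ONE LEVEL OF THE SEARCH: the value at a live node is the sum of the values at its children. [cite: MadrasSlade1993, Definition 1.2.4] -/
theorem dfsV_succ_eq_sum_kids (C N B j : ℕ) (s : S) (m : ℕ) (h : ok s = true) :
    dfsV alw upd ok cls C N B (j + 1) s m = ((kids alw upd s m).map fun p => dfsV alw upd ok cls C N B j p.1 p.2).sum := by
  rw [dfsV, if_pos h, foldr_add_eq_sum, kids, List.map_map]
  rfl

/-- A dead node has value `0`. [cite: MadrasSlade1993, Definition 1.2.4] -/
theorem dfsV_of_not_ok (C N B j : ℕ) (s : S) (m : ℕ) (h : ok s = false) : dfsV alw upd ok cls C N B j s m = 0 := by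
  cases j <;> simp [dfsV, h]

/-- The scalar count at a live node is the sum over its children. [cite: MadrasSlade1993, Definition 1.2.4] -/
theorem dfsN_succ_eq_sum_kids (c k j : ℕ) (s : S) (m : ℕ) (h : ok s = true) :
    dfsN alw upd ok cls c k (j + 1) s m = ((kids alw upd s m).map fun p => dfsN alw upd ok cls c k j p.1 p.2).sum := by
  rw [dfsN, if_pos h, foldr_add_eq_sum, kids, List.map_map]
  rfl

/-- A dead node has scalar count `0`. [cite: MadrasSlade1993, Definition 1.2.4] -/
theorem dfsN_of_not_ok (c k j : ℕ) (s : S) (m : ℕ) (h : ok s = false) : dfsN alw upd ok cls c k j s m = 0 := by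
  cases j <;> simp [dfsN, h]

end assembly

/-! ### The certified tries of the remaining cost-nine cells `N_{9,11}`, `N_{9,12}` -/

section tries

/-- The trie of the 62 valid vertical patterns of `N_{9,11}` (first letter up; bridge heights in `[1, 2]`, cost 9, no renewal time,
no immediate vertical reversal; 255 nodes), generated by the lane's `gentrie.py` and CERTIFIED by `patOK_tr9_11`. [cite: MadrasSlade1993, §4.2, eq. (4.2.20)–(4.2.22) (p. 94, 2013 reprint)] -/
def tr9_11 : Tri := (Tri.br (Tri.br (Tri.br Tri.no Tri.no (Tri.br Tri.no (Tri.br Tri.no Tri.no (Tri.br (Tri.br Tri.no Tri.no (Tri.br Tri.no (Tri.br Tri.no Tri.no (Tri.br (Tri.br Tri.no Tri.no Tri.yes) Tri.no (Tri.br Tri.yes Tri.no Tri.no))) (Tri.br Tri.no (Tri.br Tri.no Tri.no (Tri.br Tri.yes Tri.no Tri.no)) (Tri.br Tri.no Tri.no (Tri.br Tri.no Tri.no Tri.yes))))) Tri.no (Tri.br (Tri.br Tri.no Tri.no (Tri.br Tri.no (Tri.br Tri.no Tri.no (Tri.br Tri.yes Tri.no Tri.no)) (Tri.br Tri.no Tri.no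 (Tri.br Tri.no Tri.no Tri.yes)))) Tri.no (Tri.br (Tri.br Tri.no Tri.no (Tri.br Tri.no Tri.no (Tri.br Tri.no Tri.no Tri.yes))) Tri.no (Tri.br (Tri.br Tri.no Tri.no (Tri.br Tri.no Tri.no Tri.yes)) Tri.no (Tri.br (Tri.br Tri.no Tri.no Tri.yes) Tri.no (Tri.br Tri.yes Tri.no Tri.no))))))) (Tri.br Tri.no (Tri.br Tri.no Tri.no (Tri.br (Tri.br Tri.no Tri.no (Tri.br Tri.no (Tri.br Tri.no Tri.no (Tri.br Tri.yes Tri.no Tri.no)) (Tri.br Tri.no Tri.no (Tri.br Tri.no Tri.no Tri.yes)))) Tri.no (Tri.br (Tri.br Tri.no Tri.no (Tri.br Tri.no Tri.no (Tri.br Tri.no Tri.no Tri.yes))) Tri.no (Tri.br (Tri.br Tri.no Tri.no (Tri.br Tri.no Tri.no Tri.yes)) Tri.no (Tri.br (Tri.br Tri.no Tri.no Tri.yes) Tri.no (Tri.br Tri.yes Tri.no Tri.no)))))) (Tri.br Tri.no (Tri.br Tri.no Tri.no (Tri.br (Tri.br Tri.no Tri.no (Tri.br Tri.no Tri.no (Tri.br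 Tri.no Tri.no Tri.yes))) Tri.no (Tri.br (Tri.br Tri.no Tri.no (Tri.br Tri.no Tri.no Tri.yes)) Tri.no (Tri.br (Tri.br Tri.no Tri.no Tri.yes) Tri.no (Tri.br Tri.yes Tri.no Tri.no))))) (Tri.br Tri.no (Tri.br Tri.no Tri.no (Tri.br (Tri.br Tri.no Tri.no (Tri.br Tri.no Tri.no Tri.yes)) Tri.no (Tri.br (Tri.br Tri.no Tri.no Tri.yes) Tri.no (Tri.br Tri.yes Tri.no Tri.no)))) (Tri.br Tri.no (Tri.br Tri.no Tri.no (Tri.br (Tri.br Tri.no Tri.no Tri.yes) Tri.no (Tri.br Tri.yes Tri.no Tri.no))) (Tri.br Tri.no (Tri.br Tri.no Tri.no (Tri.br Tri.yes Tri.no Tri.no)) Tri.no))))))) Tri.no (Tri.br (Tri.br Tri.no Tri.no (Tri.br Tri.no (Tri.br Tri.no Tri.no (Tri.br (Tri.br Tri.no Tri.no (Tri.br Tri.no (Tri.br Tri.no Tri.no (Tri.br Tri.yes Tri.no Tri.no)) (Tri.br Tri.no Tri.no (Tri.br Tri.no Tri.no Tri.yes)))) Tri.no (Tri.br (Tri.br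 Tri.no Tri.no (Tri.br Tri.no Tri.no (Tri.br Tri.no Tri.no Tri.yes))) Tri.no (Tri.br (Tri.br Tri.no Tri.no (Tri.br Tri.no Tri.no Tri.yes)) Tri.no (Tri.br (Tri.br Tri.no Tri.no Tri.yes) Tri.no (Tri.br Tri.yes Tri.no Tri.no)))))) (Tri.br Tri.no (Tri.br Tri.no Tri.no (Tri.br (Tri.br Tri.no Tri.no (Tri.br Tri.no Tri.no (Tri.br Tri.no Tri.no Tri.yes))) Tri.no (Tri.br (Tri.br Tri.no Tri.no (Tri.br Tri.no Tri.no Tri.yes)) Tri.no (Tri.br (Tri.br Tri.no Tri.no Tri.yes) Tri.no (Tri.br Tri.yes Tri.no Tri.no))))) (Tri.br Tri.no (Tri.br Tri.no Tri.no (Tri.br (Tri.br Tri.no Tri.no (Tri.br Tri.no Tri.no Tri.yes)) Tri.no (Tri.br (Tri.br Tri.no Tri.no Tri.yes) Tri.no (Tri.br Tri.yes Tri.no Tri.no)))) (Tri.br Tri.no (Tri.br Tri.no Tri.no (Tri.br (Tri.br Tri.no Tri.no Tri.yes) Tri.no (Tri.br Tri.yes Tri.no Tri.no))) (Tri.br Tri.no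 (Tri.br Tri.no Tri.no (Tri.br Tri.yes Tri.no Tri.no)) Tri.no)))))) Tri.no (Tri.br (Tri.br Tri.no Tri.no (Tri.br Tri.no (Tri.br Tri.no Tri.no (Tri.br (Tri.br Tri.no Tri.no (Tri.br Tri.no Tri.no (Tri.br Tri.no Tri.no Tri.yes))) Tri.no (Tri.br (Tri.br Tri.no Tri.no (Tri.br Tri.no Tri.no Tri.yes)) Tri.no (Tri.br (Tri.br Tri.no Tri.no Tri.yes) Tri.no (Tri.br Tri.yes Tri.no Tri.no))))) (Tri.br Tri.no (Tri.br Tri.no Tri.no (Tri.br (Tri.br Tri.no Tri.no (Tri.br Tri.no Tri.no Tri.yes)) Tri.no (Tri.br (Tri.br Tri.no Tri.no Tri.yes) Tri.no (Tri.br Tri.yes Tri.no Tri.no)))) (Tri.br Tri.no (Tri.br Tri.no Tri.no (Tri.br (Tri.br Tri.no Tri.no Tri.yes) Tri.no (Tri.br Tri.yes Tri.no Tri.no))) (Tri.br Tri.no (Tri.br Tri.no Tri.no (Tri.br Tri.yes Tri.no Tri.no)) Tri.no))))) Tri.no (Tri.br (Tri.br Tri.no Tri.no (Tri.br Tri.no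 (Tri.br Tri.no Tri.no (Tri.br (Tri.br Tri.no Tri.no (Tri.br Tri.no Tri.no Tri.yes)) Tri.no (Tri.br (Tri.br Tri.no Tri.no Tri.yes) Tri.no (Tri.br Tri.yes Tri.no Tri.no)))) (Tri.br Tri.no (Tri.br Tri.no Tri.no (Tri.br (Tri.br Tri.no Tri.no Tri.yes) Tri.no (Tri.br Tri.yes Tri.no Tri.no))) (Tri.br Tri.no (Tri.br Tri.no Tri.no (Tri.br Tri.yes Tri.no Tri.no)) Tri.no)))) Tri.no (Tri.br (Tri.br Tri.no Tri.no (Tri.br Tri.no (Tri.br Tri.no Tri.no (Tri.br (Tri.br Tri.no Tri.no Tri.yes) Tri.no (Tri.br Tri.yes Tri.no Tri.no))) (Tri.br Tri.no (Tri.br Tri.no Tri.no (Tri.br Tri.yes Tri.no Tri.no)) Tri.no))) Tri.no (Tri.br (Tri.br Tri.no Tri.no (Tri.br Tri.no (Tri.br Tri.no Tri.no (Tri.br Tri.yes Tri.no Tri.no)) Tri.no)) Tri.no Tri.no)))))) Tri.no Tri.no)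

set_option maxHeartbeats 4000000 in
/-- ★ THE CERTIFICATE of `tr9_11`: on every reversal-free vertical pattern of length 11 starting with `up`, the trie's verdict is the computable
validity `validPatB 9` (bridge, cost 9, irreducible) — by `decide` over the 10-letter reversal-free extensions. [cite: MadrasSlade1993, §4.2, eq. (4.2.20)–(4.2.22) (p. 94, 2013 reprint)] -/
theorem patOK_tr9_11 : patOK tr9_11 9 10 [0] = true := by
  decide +kernel

/-- `tr9_11` is alive at the root. [cite: MadrasSlade1993, Definition 1.2.4] -/
theorem inTrie_tr9_11_nil : inTrie tr9_11 [] = true := by decide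

/-- The trie of the 91 valid vertical patterns of `N_{9,12}` (first letter up; bridge heights in `[1, 3]`, cost 9, no renewal time,
no immediate vertical reversal; 419 nodes), generated by the lane's `gentrie.py` and CERTIFIED by `patOK_tr9_12`. [cite: MadrasSlade1993, §4.2, eq. (4.2.20)–(4.2.22) (p. 94, 2013 reprint)] -/
def tr9_12 : Tri := (Tri.br (Tri.br (Tri.br (Tri.br Tri.no Tri.no (Tri.br Tri.no (Tri.br Tri.no (Tri.br Tri.no Tri.no (Tri.br (Tri.br (Tri.br Tri.no Tri.no (Tri.br Tri.no Tri.no (Tri.br Tri.no Tri.no Tri.yes))) Tri.no (Tri.br (Tri.br Tri.no Tri.no (Tri.br Tri.no Tri.no Tri.yes)) Tri.no (Tri.br (Tri.br Tri.no Tri.no Tri.yes) Tri.no (Tri.br Tri.yes Tri.no Tri.no)))) Tri.no (Tri.br (Tri.br (Tri.br Tri.no Tri.no (Tri.br Tri.no Tri.no Tri.yes)) Tri.no (Tri.br (Tri.br Tri.no Tri.no Tri.yes) Tri.no (Tri.br Tri.yes Tri.no Tri.no))) Tri.no (Tri.br (Tri.br (Tri.br Tri.no Tri.no Tri.yes) Tri.no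 (Tri.br Tri.yes Tri.no Tri.no)) Tri.no (Tri.br (Tri.br Tri.yes Tri.no Tri.no) Tri.no Tri.no))))) (Tri.br Tri.no (Tri.br Tri.no Tri.no (Tri.br (Tri.br (Tri.br Tri.no Tri.no (Tri.br Tri.no Tri.no Tri.yes)) Tri.no (Tri.br (Tri.br Tri.no Tri.no Tri.yes) Tri.no (Tri.br Tri.yes Tri.no Tri.no))) Tri.no (Tri.br (Tri.br (Tri.br Tri.no Tri.no Tri.yes) Tri.no (Tri.br Tri.yes Tri.no Tri.no)) Tri.no (Tri.br (Tri.br Tri.yes Tri.no Tri.no) Tri.no Tri.no)))) (Tri.br Tri.no (Tri.br Tri.no Tri.no (Tri.br (Tri.br (Tri.br Tri.no Tri.no Tri.yes) Tri.no (Tri.br Tri.yes Tri.no Tri.no)) Tri.no (Tri.br (Tri.br Tri.yes Tri.no Tri.no) Tri.no Tri.no))) (Tri.br Tri.no (Tri.br Tri.no Tri.no (Tri.br (Tri.br Tri.yes Tri.no Tri.no) Tri.no Tri.no)) Tri.no)))) (Tri.br Tri.no (Tri.br Tri.no (Tri.br Tri.no Tri.no (Tri.br (Tri.br (Tri.br Tri.no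 Tri.no (Tri.br Tri.no Tri.no Tri.yes)) Tri.no (Tri.br (Tri.br Tri.no Tri.no Tri.yes) Tri.no (Tri.br Tri.yes Tri.no Tri.no))) Tri.no (Tri.br (Tri.br (Tri.br Tri.no Tri.no Tri.yes) Tri.no (Tri.br Tri.yes Tri.no Tri.no)) Tri.no (Tri.br (Tri.br Tri.yes Tri.no Tri.no) Tri.no Tri.no)))) (Tri.br Tri.no (Tri.br Tri.no Tri.no (Tri.br (Tri.br (Tri.br Tri.no Tri.no Tri.yes) Tri.no (Tri.br Tri.yes Tri.no Tri.no)) Tri.no (Tri.br (Tri.br Tri.yes Tri.no Tri.no) Tri.no Tri.no))) (Tri.br Tri.no (Tri.br Tri.no Tri.no (Tri.br (Tri.br Tri.yes Tri.no Tri.no) Tri.no Tri.no)) Tri.no))) (Tri.br Tri.no (Tri.br Tri.no (Tri.br Tri.no Tri.no (Tri.br (Tri.br (Tri.br Tri.no Tri.no Tri.yes) Tri.no (Tri.br Tri.yes Tri.no Tri.no)) Tri.no (Tri.br (Tri.br Tri.yes Tri.no Tri.no) Tri.no Tri.no))) (Tri.br Tri.no (Tri.br Tri.no Tri.no (Tri.br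 (Tri.br Tri.yes Tri.no Tri.no) Tri.no Tri.no)) Tri.no)) (Tri.br Tri.no (Tri.br Tri.no (Tri.br Tri.no Tri.no (Tri.br (Tri.br Tri.yes Tri.no Tri.no) Tri.no Tri.no)) Tri.no) Tri.no))))) Tri.no (Tri.br (Tri.br Tri.no Tri.no (Tri.br Tri.no (Tri.br Tri.no (Tri.br Tri.no Tri.no (Tri.br (Tri.br (Tri.br Tri.no Tri.no (Tri.br Tri.no Tri.no Tri.yes)) Tri.no (Tri.br (Tri.br Tri.no Tri.no Tri.yes) Tri.no (Tri.br Tri.yes Tri.no Tri.no))) Tri.no (Tri.br (Tri.br (Tri.br Tri.no Tri.no Tri.yes) Tri.no (Tri.br Tri.yes Tri.no Tri.no)) Tri.no (Tri.br (Tri.br Tri.yes Tri.no Tri.no) Tri.no Tri.no)))) (Tri.br Tri.no (Tri.br Tri.no Tri.no (Tri.br (Tri.br (Tri.br Tri.no Tri.no Tri.yes) Tri.no (Tri.br Tri.yes Tri.no Tri.no)) Tri.no (Tri.br (Tri.br Tri.yes Tri.no Tri.no) Tri.no Tri.no))) (Tri.br Tri.no (Tri.br Tri.no Tri.no (Tri.br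 (Tri.br Tri.yes Tri.no Tri.no) Tri.no Tri.no)) Tri.no))) (Tri.br Tri.no (Tri.br Tri.no (Tri.br Tri.no Tri.no (Tri.br (Tri.br (Tri.br Tri.no Tri.no Tri.yes) Tri.no (Tri.br Tri.yes Tri.no Tri.no)) Tri.no (Tri.br (Tri.br Tri.yes Tri.no Tri.no) Tri.no Tri.no))) (Tri.br Tri.no (Tri.br Tri.no Tri.no (Tri.br (Tri.br Tri.yes Tri.no Tri.no) Tri.no Tri.no)) Tri.no)) (Tri.br Tri.no (Tri.br Tri.no (Tri.br Tri.no Tri.no (Tri.br (Tri.br Tri.yes Tri.no Tri.no) Tri.no Tri.no)) Tri.no) Tri.no)))) (Tri.br Tri.no Tri.no (Tri.br (Tri.br (Tri.br Tri.no Tri.no (Tri.br Tri.no (Tri.br Tri.no Tri.no (Tri.br (Tri.br Tri.no Tri.no Tri.yes) Tri.no (Tri.br Tri.yes Tri.no Tri.no))) (Tri.br Tri.no (Tri.br Tri.no Tri.no (Tri.br Tri.yes Tri.no Tri.no)) Tri.no))) Tri.no (Tri.br (Tri.br Tri.no Tri.no (Tri.br Tri.no (Tri.br Tri.no Tri.no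 (Tri.br Tri.yes Tri.no Tri.no)) Tri.no)) Tri.no Tri.no)) Tri.no (Tri.br (Tri.br (Tri.br Tri.no Tri.no (Tri.br Tri.no (Tri.br Tri.no Tri.no (Tri.br Tri.yes Tri.no Tri.no)) Tri.no)) Tri.no Tri.no) Tri.no Tri.no))) (Tri.br (Tri.br Tri.no Tri.no (Tri.br Tri.no (Tri.br Tri.no (Tri.br Tri.no Tri.no (Tri.br (Tri.br (Tri.br Tri.no Tri.no Tri.yes) Tri.no (Tri.br Tri.yes Tri.no Tri.no)) Tri.no (Tri.br (Tri.br Tri.yes Tri.no Tri.no) Tri.no Tri.no))) (Tri.br Tri.no (Tri.br Tri.no Tri.no (Tri.br (Tri.br Tri.yes Tri.no Tri.no) Tri.no Tri.no)) Tri.no)) (Tri.br Tri.no (Tri.br Tri.no (Tri.br Tri.no Tri.no (Tri.br (Tri.br Tri.yes Tri.no Tri.no) Tri.no Tri.no)) Tri.no) Tri.no))) (Tri.br Tri.no Tri.no (Tri.br (Tri.br (Tri.br Tri.no Tri.no (Tri.br Tri.no (Tri.br Tri.no Tri.no (Tri.br Tri.yes Tri.no Tri.no)) Tri.no)) Tri.no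 Tri.no) Tri.no Tri.no)) (Tri.br (Tri.br Tri.no Tri.no (Tri.br Tri.no (Tri.br Tri.no (Tri.br Tri.no Tri.no (Tri.br (Tri.br Tri.yes Tri.no Tri.no) Tri.no Tri.no)) Tri.no) Tri.no)) Tri.no Tri.no)))) Tri.no (Tri.br (Tri.br (Tri.br Tri.no Tri.no (Tri.br Tri.no (Tri.br Tri.no (Tri.br Tri.no Tri.no (Tri.br (Tri.br (Tri.br Tri.no Tri.no (Tri.br Tri.no Tri.no Tri.yes)) Tri.no (Tri.br (Tri.br Tri.no Tri.no Tri.yes) Tri.no (Tri.br Tri.yes Tri.no Tri.no))) Tri.no (Tri.br (Tri.br (Tri.br Tri.no Tri.no Tri.yes) Tri.no (Tri.br Tri.yes Tri.no Tri.no)) Tri.no (Tri.br (Tri.br Tri.yes Tri.no Tri.no) Tri.no Tri.no)))) (Tri.br Tri.no (Tri.br Tri.no Tri.no (Tri.br (Tri.br (Tri.br Tri.no Tri.no Tri.yes) Tri.no (Tri.br Tri.yes Tri.no Tri.no)) Tri.no (Tri.br (Tri.br Tri.yes Tri.no Tri.no) Tri.no Tri.no))) (Tri.br Tri.no (Tri.br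 Tri.no Tri.no (Tri.br (Tri.br Tri.yes Tri.no Tri.no) Tri.no Tri.no)) Tri.no))) (Tri.br Tri.no (Tri.br Tri.no (Tri.br Tri.no Tri.no (Tri.br (Tri.br (Tri.br Tri.no Tri.no Tri.yes) Tri.no (Tri.br Tri.yes Tri.no Tri.no)) Tri.no (Tri.br (Tri.br Tri.yes Tri.no Tri.no) Tri.no Tri.no))) (Tri.br Tri.no (Tri.br Tri.no Tri.no (Tri.br (Tri.br Tri.yes Tri.no Tri.no) Tri.no Tri.no)) Tri.no)) (Tri.br Tri.no (Tri.br Tri.no (Tri.br Tri.no Tri.no (Tri.br (Tri.br Tri.yes Tri.no Tri.no) Tri.no Tri.no)) Tri.no) Tri.no)))) Tri.no (Tri.br (Tri.br Tri.no Tri.no (Tri.br Tri.no (Tri.br Tri.no (Tri.br Tri.no Tri.no (Tri.br (Tri.br (Tri.br Tri.no Tri.no Tri.yes) Tri.no (Tri.br Tri.yes Tri.no Tri.no)) Tri.no (Tri.br (Tri.br Tri.yes Tri.no Tri.no) Tri.no Tri.no))) (Tri.br Tri.no (Tri.br Tri.no Tri.no (Tri.br (Tri.br Tri.yes Tri.no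 Tri.no) Tri.no Tri.no)) Tri.no)) (Tri.br Tri.no (Tri.br Tri.no (Tri.br Tri.no Tri.no (Tri.br (Tri.br Tri.yes Tri.no Tri.no) Tri.no Tri.no)) Tri.no) Tri.no))) (Tri.br Tri.no Tri.no (Tri.br (Tri.br (Tri.br Tri.no Tri.no (Tri.br Tri.no (Tri.br Tri.no Tri.no (Tri.br Tri.yes Tri.no Tri.no)) Tri.no)) Tri.no Tri.no) Tri.no Tri.no)) (Tri.br (Tri.br Tri.no Tri.no (Tri.br Tri.no (Tri.br Tri.no (Tri.br Tri.no Tri.no (Tri.br (Tri.br Tri.yes Tri.no Tri.no) Tri.no Tri.no)) Tri.no) Tri.no)) Tri.no Tri.no))) Tri.no (Tri.br (Tri.br (Tri.br Tri.no Tri.no (Tri.br Tri.no (Tri.br Tri.no (Tri.br Tri.no Tri.no (Tri.br (Tri.br (Tri.br Tri.no Tri.no Tri.yes) Tri.no (Tri.br Tri.yes Tri.no Tri.no)) Tri.no (Tri.br (Tri.br Tri.yes Tri.no Tri.no) Tri.no Tri.no))) (Tri.br Tri.no (Tri.br Tri.no Tri.no (Tri.br (Tri.br Tri.yes Tri.no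 Tri.no) Tri.no Tri.no)) Tri.no)) (Tri.br Tri.no (Tri.br Tri.no (Tri.br Tri.no Tri.no (Tri.br (Tri.br Tri.yes Tri.no Tri.no) Tri.no Tri.no)) Tri.no) Tri.no))) Tri.no (Tri.br (Tri.br Tri.no Tri.no (Tri.br Tri.no (Tri.br Tri.no (Tri.br Tri.no Tri.no (Tri.br (Tri.br Tri.yes Tri.no Tri.no) Tri.no Tri.no)) Tri.no) Tri.no)) Tri.no Tri.no)) Tri.no (Tri.br (Tri.br (Tri.br Tri.no Tri.no (Tri.br Tri.no (Tri.br Tri.no (Tri.br Tri.no Tri.no (Tri.br (Tri.br Tri.yes Tri.no Tri.no) Tri.no Tri.no)) Tri.no) Tri.no)) Tri.no Tri.no) Tri.no Tri.no)))) Tri.no Tri.no)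

set_option maxHeartbeats 4000000 in
/-- ★ THE CERTIFICATE of `tr9_12`: on every reversal-free vertical pattern of length 12 starting with `up`, the trie's verdict is the computable
validity `validPatB 9` (bridge, cost 9, irreducible) — by `decide` over the 11-letter reversal-free extensions. [cite: MadrasSlade1993, §4.2, eq. (4.2.20)–(4.2.22) (p. 94, 2013 reprint)] -/
theorem patOK_tr9_12 : patOK tr9_12 9 11 [0] = true := by
  decide +kernel

/-- `tr9_12` is alive at the root. [cite: MadrasSlade1993, Definition 1.2.4] -/
theorem inTrie_tr9_12_nil : inTrie tr9_12 [] = true := by decide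

end tries


end WordTypes

end Literature.Probability.RandomPlanarGeometry.SAW.Zd
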